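import Mathlib
import Summits.MatrixMultiplication.MatrixMultiplication.Theses.FourierTwoFamiliesModP

/-!
# Line `collision-profile-removal` — skeleton for crux `PrimeDensityDecay` (stmt-MatrixMultiplication-14311)

LEAD COPY (prover-line-stmt-MatrixMultiplication-14311-0): the working skeleton of the picked line; stubs are replaced by
landed theorems as they are accepted.  Reshapes are recorded in the `Registered stubs` section.

Crux (route `FourierTwoFamiliesModP`, rank 4): `∀ ε > 0 ∃ s₀ ∀ p prime ∀ n s (A B : Fin n → Finset (ZMod p)),
s₀ ≤ s → balanced(s) → (W) → (X) → n·s ≤ ε·p`.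

Notation (informal): `X = ⊔ A i`, `Y = ⊔ B i`, `ρ = n s / p`, `X₀ = privDiff A B = ⋃ (A i − B i)`,
`D(d) = #{(i,a,b) : a ∈ A i, b ∈ B i, a − b = d}` (≤ n under (W)), `Σ_d D(d) = n s²`,
`coincidences A B = Σ_d D(d)²` (verbatim the statistic of line kronecker-coupling / triage W2.lean),
`m* = coincidences / (n s²)` = mass-average sharing multiplicity ("collision number").

## The line (idea card collision-profile-removal, ideator 3; triage r1-1/2/3: pass-as-lemma, merge with K1)

1. `LowCollisionDecay` (the card's lemma, threshold normalised to `K·s·(n s²)` as all three triagers required):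
   `m* ≤ K s ⇒ n s ≤ ε p` for `s ≥ s₀(K, ε)`.  Engine: Green's arithmetic removal lemma (tree THEOREM
   `Literature.Combinatorics.Additive.Green2005_1_5_holds`, k = 3, sets `X, −Y, −X₀`) + Cauchy–Schwarz on the
   deleted differences.  Contains `RemovalRegime` (n ≤ K s ⇒ D ≤ n ≤ K s ⇒ m* ≤ K s).  Provable now (M/L).
2. `MassConcentration` (the removal lemma's FULL export, which the card's Cauchy–Schwarz step consumes):
   `∀ η > 0 ∃ s₀`: every balanced SDPP family with `s ≥ s₀` has a set `R ⊆ X₀`, `|R| ≤ η p`, carrying matched mass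
   `≥ n s² − 2 η p s`.  Provable now (M/L); `LowCollisionDecay` is its corollary with `η = ε/(4(K+1))`.
3. `HereditaryBias` (new structural export for the core, provable now, M): for EVERY `Z ⊆ X₀` there is a
   nontrivial character `ψ` of `ZMod p` with `‖Σ_{z∈Z} ψ z‖ ≥ (n s/p)·|Z| − s` — because (X) forces
   `X ∩ (y + Z) ⊆ A k` for `y ∈ B k` (at most `s` points against the mean `ρ|Z|`), and one Plancherel + one
   Cauchy–Schwarz turn the deficiency into a Fourier coefficient of `Z`.  Relative bias `≥ ρ − s/|Z|`, uniformly
   over subsets: the sharpest linear-Fourier fact available on this crux, and hereditary (it survives every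
   localisation of the concentration set `R`).
4. `ConcentratedCoreDecay` (the open core, HARDEST): in the high-collision regime `K·s·(n s²) < coincidences`,
   GIVEN a concentration set `R` as in 2 and the hereditary bias of 3 as hypotheses, `n s ≤ ε p`; the prover chooses
   `K`, `η`, `s₀` after `ε`.  All known designs (translates, radix digit designs, CRT cubes) are in the extreme point
   `m* = n` (common grid); a Bohr-set density iteration on `R` driven by 3 closes only when `|R| ≥ p^{1−o(1)}`, while
   `|R|` may be as small as `s²/2` — the missing input is a sparse-to-dense transference for `R` (or factorisation
   rigidity at the common-grid extreme), see the line card.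

`primeDensityDecay_of_parts : LowCollisionDecay → MassConcentration → HereditaryBias → ConcentratedCoreDecay →
PrimeDensityDecay` is kernel-checked below (sorry-free; case split on `coincidences ≤ K·s·(n s²)`), and
`PrimeDensityDecay_of : PrimeDensityDecay` applies it to the four registered `stub_*` theorems.

Disproof used (cdisprove v1–v4, via item evidence notes): `_false_without_W` / `_false_without_W'` — (W) is used in
stubs 1–2 (`p ≥ s²`, `D ≤ n`, each element in exactly `s` matched pairs); `_false_without_X` — (X) is the faithfulness
behind the solution count `n s²` (stubs 1, 2) and behind `X ∩ (y+Z) ⊆ A k` (stub 3); `_false_without_prime` — every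
stub quantifies over `p.Prime`; `translate_bound_tight` / `sdpp_lift` / `densityDecay_all_moduli_of_crux` are respected
(translates have `m* = n`, inside stub 4's regime; nothing here is modulus-specific beyond primality).  No landed
Negative lemma exists for this crux (ledger negatives, 2026-08-16: 4 unrelated entries).
-/

namespace Summit.MatrixMultiplication.MatrixMultiplication.Cruxes.PrimeDensityDecay.CollisionProfileRemoval

open scoped BigOperators Pointwise
open Finset
open Summit.MatrixMultiplication.MatrixMultiplication.Theses.FourierTwoFamiliesModP

/-! ## Statistics of a pair family -/

/-- `Σ_d D(d)²`: ordered pairs of matched pairs `(a,b) ∈ A i × B i`, `(a',b') ∈ A j × B j` with equal difference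
(verbatim the `coincidences` of line kronecker-coupling and of the triage certificate W2.lean). -/
def coincidences {p n : ℕ} (A B : Fin n → Finset (ZMod p)) : ℕ :=
  ∑ i, ∑ j, (((A i ×ˢ B i) ×ˢ (A j ×ˢ B j)).filter fun q => q.1.1 - q.1.2 = q.2.1 - q.2.2).card

/-- Matched mass on a set of differences `R`: `#{(i,a,b) : a ∈ A i, b ∈ B i, a - b ∈ R} = Σ_{d ∈ R} D(d)`. -/
def mass {p n : ℕ} (A B : Fin n → Finset (ZMod p)) (R : Finset (ZMod p)) : ℕ :=
  ∑ i, ((A i ×ˢ B i).filter fun q => q.1 - q.2 ∈ R).card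

/-- The private (matched) difference set `X₀ = ⋃ᵢ (A i − B i)`. -/
def privDiff {p n : ℕ} (A B : Fin n → Finset (ZMod p)) : Finset (ZMod p) :=
  Finset.univ.biUnion fun i => A i - B i

/-! ## The four stub statements -/

/-- STUB 1 (the card's lemma, normalised; provable now from `Green2005_1_5_holds` + Cauchy–Schwarz, M/L):
low collision number `coincidences ≤ K·s·(n s²)` (mass-average sharing multiplicity `m* ≤ K s`) forces density
`≤ ε` once `s ≥ s₀(K, ε)`.  Contains route support `RemovalRegime` (n ≤ K s). -/
def LowCollisionDecay : Prop :=
  ∀ (K : ℕ) (ε : ℝ), 0 < ε → ∃ s₀ : ℕ, ∀ p : ℕ, p.Prime → ∀ (n s : ℕ) (A B : Fin n → Finset (ZMod p)),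
    s₀ ≤ s → (∀ i : Fin n, (A i).card = s ∧ (B i).card = s) →
    (∀ i : Fin n, ∀ a ∈ A i, ∀ a' ∈ A i, ∀ b ∈ B i, ∀ b' ∈ B i, (a - a') + (b - b') = 0 → a = a' ∧ b = b') →
    (∀ i j k : Fin n, ∀ a ∈ A i, ∀ a' ∈ A j, ∀ b ∈ B j, ∀ b' ∈ B k, (a - a') + (b - b') = 0 → i = k) →
    coincidences A B ≤ K * s * (n * s ^ 2) →
    (n : ℝ) * (s : ℝ) ≤ ε * (p : ℝ)

/-- STUB 2 (removal export, provable now from `Green2005_1_5_holds` with k = 3 on `(X, −Y, −X₀)`, M/L): for every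
`η > 0`, once `s ≥ s₀(η)` some set `R ⊆ X₀` of at most `η p` differences carries all but `2 η p s` of the matched
mass `n s²` (deleting `≤ η p` elements of `X` or of `Y` kills `≤ η p s` matched pairs each; the rest die on `R`). -/
def MassConcentration : Prop :=
  ∀ η : ℝ, 0 < η → ∃ s₀ : ℕ, ∀ p : ℕ, p.Prime → ∀ (n s : ℕ) (A B : Fin n → Finset (ZMod p)),
    s₀ ≤ s → (∀ i : Fin n, (A i).card = s ∧ (B i).card = s) →
    (∀ i : Fin n, ∀ a ∈ A i, ∀ a' ∈ A i, ∀ b ∈ B i, ∀ b' ∈ B i, (a - a') + (b - b') = 0 → a = a' ∧ b = b') →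
    (∀ i j k : Fin n, ∀ a ∈ A i, ∀ a' ∈ A j, ∀ b ∈ B j, ∀ b' ∈ B k, (a - a') + (b - b') = 0 → i = k) →
    ∃ R : Finset (ZMod p), R ⊆ privDiff A B ∧ (R.card : ℝ) ≤ η * (p : ℝ) ∧
      (n : ℝ) * (s : ℝ) ^ 2 - 2 * η * (p : ℝ) * (s : ℝ) ≤ (mass A B R : ℝ)

/-- STUB 3 (hereditary Fourier bias of the private differences, provable now, M): under (X) and balance, EVERY
subset `Z ⊆ X₀` has a nontrivial additive character `ψ` with `‖Σ_{z ∈ Z} ψ z‖ ≥ (n s / p)·|Z| − s`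
(faithfulness `X ∩ (y + Z) ⊆ A k` for `y ∈ B k`, Plancherel on `ZMod p`, Cauchy–Schwarz on `Σ_ψ |X̂(ψ)||Ŷ(ψ)|`). -/
def HereditaryBias : Prop :=
  ∀ p : ℕ, p.Prime → ∀ (n s : ℕ) (A B : Fin n → Finset (ZMod p)),
    (∀ i : Fin n, (A i).card = s ∧ (B i).card = s) →
    (∀ i j k : Fin n, ∀ a ∈ A i, ∀ a' ∈ A j, ∀ b ∈ B j, ∀ b' ∈ B k, (a - a') + (b - b') = 0 → i = k) →
    ∀ Z : Finset (ZMod p), Z ⊆ privDiff A B →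
      ∃ ψ : AddChar (ZMod p) ℂ, ψ ≠ 1 ∧
        (n : ℝ) * (s : ℝ) / (p : ℝ) * (Z.card : ℝ) - (s : ℝ) ≤ ‖∑ z ∈ Z, ψ z‖

/-- STUB 4 (the open core, HARDEST): in the high-collision regime, given a concentration set `R` (stub 2) and the
hereditary bias (stub 3) as hypotheses, the family has density `≤ ε`; `K`, `η`, `s₀` are the prover's to choose. -/
def ConcentratedCoreDecay : Prop :=
  ∀ ε : ℝ, 0 < ε → ∃ (K : ℕ) (η : ℝ) (s₀ : ℕ), 0 < η ∧
    ∀ p : ℕ, p.Prime → ∀ (n s : ℕ) (A B : Fin n → Finset (ZMod p)),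
    s₀ ≤ s → (∀ i : Fin n, (A i).card = s ∧ (B i).card = s) →
    (∀ i : Fin n, ∀ a ∈ A i, ∀ a' ∈ A i, ∀ b ∈ B i, ∀ b' ∈ B i, (a - a') + (b - b') = 0 → a = a' ∧ b = b') →
    (∀ i j k : Fin n, ∀ a ∈ A i, ∀ a' ∈ A j, ∀ b ∈ B j, ∀ b' ∈ B k, (a - a') + (b - b') = 0 → i = k) →
    K * s * (n * s ^ 2) < coincidences A B →
    (∃ R : Finset (ZMod p), R ⊆ privDiff A B ∧ (R.card : ℝ) ≤ η * (p : ℝ) ∧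
      (n : ℝ) * (s : ℝ) ^ 2 - 2 * η * (p : ℝ) * (s : ℝ) ≤ (mass A B R : ℝ)) →
    (∀ Z : Finset (ZMod p), Z ⊆ privDiff A B →
      ∃ ψ : AddChar (ZMod p) ℂ, ψ ≠ 1 ∧
        (n : ℝ) * (s : ℝ) / (p : ℝ) * (Z.card : ℝ) - (s : ℝ) ≤ ‖∑ z ∈ Z, ψ z‖) →
    (n : ℝ) * (s : ℝ) ≤ ε * (p : ℝ)

/-! ## Registered stubs

LEAD RESHAPE (prover-line-stmt-MatrixMultiplication-14311-0, 2026-08-16): `stub_lowCollisionDecay` is registered as the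
IMPLICATION `MassConcentration → LowCollisionDecay` (pure Cauchy–Schwarz on the multiplicity profile: `mass R ≥ n s²/2`,
`(mass R)² ≤ |R| · coincidences ≤ η p · K s · n s²`), so that Green's removal lemma is formalised exactly once (in
`stub_massConcentration`); the composition feeds it `stub_massConcentration`.  Stub files land under
`Theorems/FourierTwoFamiliesModPPrimeDensityDecayStub<Name>.lean` with the three `def`s below inlined verbatim (Mathlib-only
files), and are plugged in here by definitional unfolding. -/

theorem stub_lowCollisionDecay : MassConcentration → LowCollisionDecay := by
  sorry

theorem stub_massConcentration : MassConcentration := by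
  sorry

theorem stub_hereditaryBias : HereditaryBias := by
  sorry

theorem stub_concentratedCoreDecay : ConcentratedCoreDecay := by
  sorry

/-! ## Composition (kernel-checked, no sorry of its own): the four stub statements imply the crux BY NAME

`primeDensityDecay_of_parts` is the implication `LowCollisionDecay → MassConcentration → HereditaryBias →
ConcentratedCoreDecay → PrimeDensityDecay` (a `def` so that the skeleton audit sees exactly one theorem concluding the
crux); `PrimeDensityDecay_of` applies it to the four registered stubs. -/

set_option linter.defProp false in
/-- The glue: case split on the collision number `coincidences A B ≤ K·s·(n s²)`; low ⇒ stub 1; high ⇒ stub 4 fed by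
the concentration set of stub 2 and the hereditary bias of stub 3.  Sorry-free.  (A `def` on purpose: the
skeleton audit takes THE theorem concluding the crux to be the unique `theorem` with that conclusion.) -/
def primeDensityDecay_of_parts :
    LowCollisionDecay → MassConcentration → HereditaryBias → ConcentratedCoreDecay →
      Summit.MatrixMultiplication.MatrixMultiplication.Theses.FourierTwoFamiliesModP.PrimeDensityDecay := by
  intro hLow hConc hBias hCore ε hε
  obtain ⟨K, η, s₁, hη, hCore'⟩ := hCore ε hε
  obtain ⟨s₂, hConc'⟩ := hConc η hη
  obtain ⟨s₃, hLow'⟩ := hLow K ε hε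
  refine ⟨max s₁ (max s₂ s₃), ?_⟩
  intro p hp n s A B hs hcard hW hX
  have hs₁ : s₁ ≤ s := le_trans (le_max_left _ _) hs
  have hs₂ : s₂ ≤ s := le_trans (le_trans (le_max_left _ _) (le_max_right _ _)) hs
  have hs₃ : s₃ ≤ s := le_trans (le_trans (le_max_right _ _) (le_max_right _ _)) hs
  by_cases hlow : coincidences A B ≤ K * s * (n * s ^ 2)
  · exact hLow' p hp n s A B hs₃ hcard hW hX hlow
  · exact hCore' p hp n s A B hs₁ hcard hW hX (Nat.lt_of_not_le hlow)
      (hConc' p hp n s A B hs₂ hcard hW hX) (hBias p hp n s A B hcard hX)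

/-- THE SKELETON THEOREM: the crux `PrimeDensityDecay`, by name, from the four registered stubs (its only sorries are
theirs). -/
theorem PrimeDensityDecay_of :
    Summit.MatrixMultiplication.MatrixMultiplication.Theses.FourierTwoFamiliesModP.PrimeDensityDecay :=
  primeDensityDecay_of_parts (stub_lowCollisionDecay stub_massConcentration) stub_massConcentration
    stub_hereditaryBias stub_concentratedCoreDecay

end Summit.MatrixMultiplication.MatrixMultiplication.Cruxes.PrimeDensityDecay.CollisionProfileRemoval
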